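import Summits.BirchSwinnertonDyer.BirchSwinnertonDyer.Theorems.AlignedTransportAtTwoMainConjectureTransportAlignedAtTwoKilfordKernelLetterCrossLevelIharaStep
import Summits.BirchSwinnertonDyer.BirchSwinnertonDyer.Theorems.AlignedTransportAtTwoMainConjectureTransportAlignedAtTwoKilfordCopyCrossLevelSquarefreePairs
import Summits.BirchSwinnertonDyer.BirchSwinnertonDyer.Theorems.AlignedTransportAtTwoMainConjectureTransportAlignedAtTwoKilfordCopyCrossLevelOldLinesHeckeIdeal
import HarnessLib

/-!
# Crux C1 `MainConjectureTransportAlignedAtTwo` (stmt-BirchSwinnertonDyer-22296), line `birth`, residual (R2) `stub_lamLawKilford` (Kilford stratum),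
# UNEQUAL conductors, SQUAREFREE ratio: row (r5) for the ITERATED old line `F_Q = Σ_{T⊆Q} (∏T)·ι_{∏T} f` — by induction on `Q` from the Ihara step
# (width seat att-p4 g18; `--supports 22296`)

THEOREMS ONLY (no `def`, no `sorry`, no instance); CONDITIONAL on the PRINT named fact `ihara_periodHomology_mod_eisenstein` (Literature, this seat). BSD is not proved
by this; C1 is not closed by this.

att-p3 g18's squarefree / two-sided / semistable reductions (`…CrossLevelSquarefree*`, `…TwoSided`, `…Semistable`, `…PlaneOnly`) read the pair through the
`m`-old lines `F_Q` (`m = ∏Q` squarefree, `a_n(F_Q) = Σ_{T⊆Q} (∏T)·a_{n/∏T}(f)`; existence `…SquarefreePairs.exists_oldLines`, lattice condition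
`…OldLinesHeckeIdeal.mul_apply_oldLines_mem`, Hecke eigen-property off `Q` `…OldLinesHecke.heckeT_oldLines_of_not_mem`). The kernel-letter consumer at the common level
(`…CrossLevelCarrierForms.uniformize_twoForms_ker_iff_of_carrier`) needs the half-class functional of EACH `F_Q` to be NON-ZERO — row (r5). THIS file proves it:
* §1 `sum_powerset_insert_oldLines` — the `q`-expansion identity `a_n(F_{Q ∪ {q}}) = a_n(F_Q) + q·a_{n/q}(F_Q)` (`Finset.sum_powerset_insert`).
* §2 **`exists_uniformize_oldLines_half_ne_zero`** — for `f ∈ S₂(Γ₀(N₁))` with `c·Λ_f ⊆ Λ_W`, `T_ℓ f = a_ℓ(W) f` (`ℓ ∤ N₁`), `u_W(c·x(f)/2) ≠ O` for some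
  `x ∈ H₁(X₀(N₁);ℤ)` (at the newform level: `…CrossLevelCarrierLift.exists_jacobiMap_half_ne_zero_of_lift`), and primes `Q` off `N₁`: for every `L = N₁·∏Q` and every
  `F` with the `F_Q` expansion, `u_W(c·y(F)/2) ≠ O` for some `y ∈ H₁(X₀(L);ℤ)`. Induction on `Q`: the step is `…CrossLevelIharaStep.exists_uniformize_oldLine_half_ne_zero_of_form`
  at the levels `N₁·∏Q' ∣ N₁·∏Q'·q`.

References: [DarmonDiamondTaylor1995, Lemma 4.28 (a) (p. 135), Lemma 4.30 (b) (p. 136), Prop. 2.6 (b)]; [Ribet1990, Thm. 4.1]; [DiamondShurman2005, §5.7, Prop. 5.6.2];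
[CremonaAlgorithms1997, §2.4].
-/

set_option autoImplicit false

noncomputable section

-- justification: the `Summit.BirchSwinnertonDyer.BirchSwinnertonDyer.…` path repeats a component (route-file convention)
set_option linter.dupNamespace false

open scoped MatrixGroups ModularForm NumberField Classical
open CongruenceSubgroup Polynomial WeierstrassCurve NumberField IsDedekindDomain Field Module
open Literature.NumberTheory.EllipticCurves Literature.NumberTheory.EllipticCurves.ModularForms
open Literature.NumberTheory.EllipticCurves.Greenberg1999
open Summit.BirchSwinnertonDyer.Rank1Residual Summit.BirchSwinnertonDyer.Rank1Residual.F1Sign2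
open Summit.BirchSwinnertonDyer.BirchSwinnertonDyer.Theorems.AlignedTransportAtTwoKilfordCopyCrossLevelSquarefreePairs
open Summit.BirchSwinnertonDyer.BirchSwinnertonDyer.Theorems.AlignedTransportAtTwoKilfordCopyCrossLevelOldLinesHecke
open Summit.BirchSwinnertonDyer.BirchSwinnertonDyer.Theorems.AlignedTransportAtTwoKilfordCopyCrossLevelOldLinesHeckeIdeal
open Summit.BirchSwinnertonDyer.BirchSwinnertonDyer.Theorems.AlignedTransportAtTwoKilfordKernelLetterCrossLevelIharaStep

namespace Summit.BirchSwinnertonDyer.BirchSwinnertonDyer.Theorems.AlignedTransportAtTwoKilfordKernelLetterCrossLevelIharaSquarefree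

/-! ## §1 The `q`-expansion of `F_{Q ∪ {q}}` through `F_Q` -/

/-- **`a_n(F_{Q∪{q}}) = a_n(F_Q) + q·𝟙_{q∣n}·a_{n/q}(F_Q)`** for the iterated old-line coefficients `a_n(F_Q) = Σ_{T⊆Q} (∏T)·𝟙_{∏T∣n}·a(n/∏T)` (`q ∉ Q`).
[cite: DiamondShurman2005, §5.7] -/
theorem sum_powerset_insert_oldLines (Q : Finset ℕ) {q : ℕ} (hqQ : q ∉ Q) (a : ℕ → ℂ) (n : ℕ) :
    ∑ T ∈ (insert q Q).powerset, ((∏ x ∈ T, x : ℕ) : ℂ) * (if (∏ x ∈ T, x) ∣ n then a (n / ∏ x ∈ T, x) else 0) =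
      ∑ T ∈ Q.powerset, ((∏ x ∈ T, x : ℕ) : ℂ) * (if (∏ x ∈ T, x) ∣ n then a (n / ∏ x ∈ T, x) else 0) +
        (q : ℂ) * (if q ∣ n then
          ∑ T ∈ Q.powerset, ((∏ x ∈ T, x : ℕ) : ℂ) * (if (∏ x ∈ T, x) ∣ n / q then a (n / q / ∏ x ∈ T, x) else 0) else 0) := by
  classical
  rw [Finset.sum_powerset_insert hqQ]
  congr 1
  have hqT : ∀ T ∈ Q.powerset, q ∉ T := fun T hT h ↦ hqQ (Finset.mem_powerset.mp hT h)
  by_cases hqn : q ∣ n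
  · rw [if_pos hqn, Finset.mul_sum]
    refine Finset.sum_congr rfl fun T hT ↦ ?_
    rw [Finset.prod_insert (hqT T hT)]
    have hiff : q * ∏ x ∈ T, x ∣ n ↔ ∏ x ∈ T, x ∣ n / q := (Nat.dvd_div_iff_mul_dvd hqn).symm
    have hdiv : n / (q * ∏ x ∈ T, x) = n / q / ∏ x ∈ T, x := (Nat.div_div_eq_div_mul n q _).symm
    by_cases h : ∏ x ∈ T, x ∣ n / q
    · rw [if_pos (hiff.mpr h), if_pos h, hdiv]; push_cast; ring
    · rw [if_neg (fun h' ↦ h (hiff.mp h')), if_neg h]; ring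
  · rw [if_neg hqn, mul_zero]
    refine Finset.sum_eq_zero fun T hT ↦ ?_
    rw [Finset.prod_insert (hqT T hT), if_neg (fun h ↦ hqn (Dvd.dvd.trans (Dvd.intro _ rfl) h)), mul_zero]

/-! ## §2 (r5) for the iterated old line, by induction on the set of primes -/

/-- **(r5) for `F_Q`: the half-class functional of the `m`-old line is non-zero** (`m = ∏Q` squarefree, primes off `N₁`), from the Ihara step by induction on
`Q`, given the non-vanishing at the base level `N₁`. See the module docstring. [cite: DarmonDiamondTaylor1995, Lemma 4.28 (a) (p. 135) and Prop. 2.6 (b)]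
[cite: Ribet1990, Thm. 4.1] [cite: DiamondShurman2005, §5.7, Prop. 5.6.2] -/
theorem exists_uniformize_oldLines_half_ne_zero (hIh : ihara_periodHomology_mod_eisenstein)
    (W : WeierstrassCurve ℚ) [W.IsElliptic] [W.IsGloballyMinimal] (ht : ∀ x : ℚ, ¬ HasRationalTwoTorsionX W x)
    {N₀ N₁ : ℕ} [NeZero N₀] [NeZero N₁] (D : ModularParametrizationData W N₀) (f : CuspForm (Gamma0 N₁) 2)
    (hc : ∀ z ∈ periodLattice f, (D.c : ℂ) * z ∈ D.L.lattice)
    (hTf : ∀ (ℓ : ℕ) (hℓ : ℓ.Prime), ¬ ℓ ∣ N₁ → (haveI : NeZero ℓ := ⟨hℓ.ne_zero⟩; heckeT (Gamma0 N₁) 2 ℓ f) = ((W.LFunction ℓ : ℤ) : ℂ) • f)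
    (hnz : ∃ x ∈ periodHomology N₁, D.uniformize ((D.c : ℂ) * x f / 2) ≠ 0)
    (Q : Finset ℕ) (hQ : ∀ q ∈ Q, q.Prime) (hQN₁ : ∀ q ∈ Q, ¬ q ∣ N₁) :
    ∀ (L : ℕ) [NeZero L], L = N₁ * ∏ q ∈ Q, q → ∀ (F : CuspForm (Gamma0 L) 2),
      (∀ n : ℕ, cuspCoeff F n = ∑ T ∈ Q.powerset, ((∏ x ∈ T, x : ℕ) : ℂ) * (if (∏ x ∈ T, x) ∣ n then cuspCoeff f (n / ∏ x ∈ T, x) else 0)) →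
      ∃ y ∈ periodHomology L, D.uniformize ((D.c : ℂ) * y F / 2) ≠ 0 := by
  classical
  induction Q using Finset.induction_on with
  | empty =>
    intro L _ hL F hF
    have hL1 : L = N₁ := by simpa using hL
    subst hL1
    have hFf : F = f := eq_of_forall_cuspCoeff_eq_gamma0 fun n ↦ by
      rw [hF n]
      simp
    rw [hFf]
    exact hnz
  | insert q Q' hqQ' ih =>
    intro L _ hL F hF
    have hq : q.Prime := hQ q (Finset.mem_insert_self q Q')
    have hQ' : ∀ x ∈ Q', x.Prime := fun x hx ↦ hQ x (Finset.mem_insert_of_mem hx)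
    have hQN₁' : ∀ x ∈ Q', ¬ x ∣ N₁ := fun x hx ↦ hQN₁ x (Finset.mem_insert_of_mem hx)
    haveI : NeZero q := ⟨hq.ne_zero⟩
    -- the intermediate level `L' = N₁·∏Q'`
    set L' : ℕ := N₁ * ∏ x ∈ Q', x with hL'
    haveI : NeZero L' := ⟨mul_ne_zero (NeZero.ne N₁) (Finset.prod_ne_zero_iff.mpr fun x hx ↦ (hQ' x hx).ne_zero)⟩
    have hLq : L = L' * q := by rw [hL, Finset.prod_insert hqQ', hL']; ring
    have hqL' : ¬ q ∣ L' := by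
      intro h
      rcases (Nat.Prime.dvd_mul hq).mp h with h | h
      · exact hQN₁ q (Finset.mem_insert_self q Q') h
      · obtain ⟨x, hx, hqx⟩ := (Prime.dvd_finsetProd_iff hq.prime _).mp h
        exact hqQ' (((Nat.prime_dvd_prime_iff_eq hq (hQ' x hx)).mp hqx) ▸ hx)
    -- the `Q'`-old line at `L'` and the induction hypothesis
    obtain ⟨F', hF'⟩ := exists_oldLines (L := L') Q' (fun x hx ↦ (hQ' x hx).ne_zero) dvd_rfl f
    obtain ⟨x', hx', hne'⟩ := ih hQ' hQN₁' L' rfl F' hF'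
    -- its lattice condition and Hecke eigen-property off `L`
    have hgΛ : ∀ φ ∈ periodHomology L', (D.c : ℂ) * φ F' ∈ D.L.lattice := fun φ hφ ↦
      mul_apply_oldLines_mem Q' hQ' dvd_rfl f F' hF' D.L.lattice.toAddSubgroup (D.c : ℂ) hc hφ
    have hTg : ∀ (ℓ : ℕ) [NeZero ℓ], ℓ.Prime → ¬ ℓ ∣ L → heckeT (Gamma0 L') 2 ℓ F' = ((W.LFunction ℓ : ℤ) : ℂ) • F' := by
      intro ℓ _ hℓ hℓL
      have hℓL' : ¬ ℓ ∣ L' := fun h ↦ hℓL (hLq ▸ h.mul_right q)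
      have hℓN₁ : ¬ ℓ ∣ N₁ := fun h ↦ hℓL' (h.mul_right _)
      have hℓQ' : ℓ ∉ Q' := fun h ↦ hℓL' (Dvd.dvd.mul_left (Finset.dvd_prod_of_mem (fun x : ℕ ↦ x) h) N₁)
      exact heckeT_oldLines_of_not_mem Q' hQ' dvd_rfl f F' hF' hℓ hℓQ' ⟨fun h ↦ absurd h hℓN₁, fun h ↦ absurd h hℓL'⟩ _ (hTf ℓ hℓ hℓN₁)
    -- `F` is the `q`-old line of `F'`
    have hFF' : ∀ n : ℕ, cuspCoeff F n = cuspCoeff F' n + (q : ℂ) * (if q ∣ n then cuspCoeff F' (n / q) else 0) := by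
      intro n
      rw [hF n, sum_powerset_insert_oldLines Q' hqQ' (fun m ↦ cuspCoeff f m) n, hF' n]
      congr 2
      split_ifs with hqn
      · rw [hF' (n / q)]
      · rfl
    exact exists_uniformize_oldLine_half_ne_zero_of_form hIh W ht hq hqL' hLq D F' hgΛ hTg F hFF' ⟨x', hx', hne'⟩

end Summit.BirchSwinnertonDyer.BirchSwinnertonDyer.Theorems.AlignedTransportAtTwoKilfordKernelLetterCrossLevelIharaSquarefree

end
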